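import Summits.AtomisticToContinuum.FouriersLaw.Theorems.BondHeatUncertaintyBoundedResponseBathHeatLogWindowC
import HarnessLib
/-!
# NODE 113 (decomp-a2c · lens-1 «grading / quantitative ladder», gen 113) — THE LOG-WINDOW LAW and THE MIXING DOOR

Blocker of record: `Theses.BondHeatUncertainty.BoundedResponse` (stmt-11071) ⟸ (S) `SubdiffusiveBondHeat` ∧ `LateTailFloor a 1 1`
(tree door `boundedResponse_of_subdiffusiveBondHeat_lateTailFloor`).  NODE 112 (tree, `…BathHeatHorizonReturn{A,B,C,D,∅}`) reached
`LateTailFloor a 1 1 ⟸ (HZᶠ_{q,1}) ∧ (HM_{a,q,δ})` — a horizon-remainder floor at the polynomial horizon `N^q` and CONFINED monotonicity of the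
horizon heat-return curve on the POWER window `k² ≤ T·N^δ`, the window paying for the free `L²` budget `O(N^{2q+4})` through the POLYNOMIAL
confinement lemma (`(κ²)^{−j}`).

THIS NODE re-grades both open pieces at theorem level:

* §8–§9 **the GAUSSIAN confinement lemma** `thermalCrossDefect_le_of_monotoneSqOn_exp`: `𝔇_T(g) ≤ A_T·e^{−κ²/(8T)}·(1 + ‖g‖²)` for `g`
  nondecreasing in `k²` on `k² ≤ κ²` only (`κ² ≥ 4T`).  The outer cost is paid with the weight `e^{κ²/(8T)}` inside the weighted AM–GM; its
  moments are finite by WIDTH DOUBLING `φ_T·e^{k²/(4T)} = √2·φ_{2T}`.  Consequence — **the LOG-WINDOW LAW**: a budget `‖g‖² ≤ P` is neutralised by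
  the window `κ² = 8T·log P` (NODE 112: `κ² = P^{1/j}`).
* §10 horizon `τ` and window `w` become free parameters (`HorizonRemainderFloorAt τ g`, `HorizonReturnMonotoneWithin a τ w`; NODE 112's pieces
  are the points `τ = N^q`, `w = T·N^δ`, by `Iff.rfl`), the canonical window of a horizon is `logWindow τ T N = 16T·log τ_N + 32T·log N + 8T`, and
  the GENERAL DOOR `lateTailFloor_one_of_horizonAt_logWindow`: `(HZᶠ[τ]_1) ∧ (HM[τ, W_T(τ)]_a) ⟹ LateTailFloor a 1 1` for any `τ_N ≥ N³`.
  At `τ = N^q`: `(HZᶠ_{q,1}) ∧ (HMlog_{a,q}) ⟹ floor` with the window `8T((2q+4)log N + 1)`, and `(HM_{a,q,δ}) ⟹ (HMlog_{a,q})` is PROVED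
  (`horizonReturnMonotoneLog_of_on`): the new piece is weaker than NODE 112's by a theorem.
* §11 **the MIXING DOOR**: the canonical RELAXATION TIME `ρ_N := inf{ρ ≥ 1 : |K_N(r)| ≤ 2T²e^{1−r/ρ} ∀ r ≥ 0} + 1` of the boundary kernel is
  FINITE for every `N` by the tree's per-`N` exponential mixing (`boundaryKernelBasics_proof` (d) ⟵ CEHR 2018 Thm 2.13, checked), with no claim
  on its growth; at the MIXING HORIZON `τ^mix_N := N³·ρ_N·(1 + log ρ_N)` the remainder piece is a TREE THEOREM at grade one
  (`horizonRemainderFloorAt_mixingHorizon`), so ONE open piece remains: `(HMmix_a)` = confined monotonicity of `𝔊^{τ^mix}` on the log-mixing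
  window `16T·log ρ_N + 80T·log N + 16T·log(1 + log ρ_N) + 8T`.  ★★★ `lateTailFloor_one_of_mixing : (HMmix_a) ⟹ LateTailFloor a 1 1`;
  `boundedResponse_of_subdiffusiveBondHeat_mixing : (S) ∧ (HMmix_a) ⟹ 11071`.  The unknown `N`-dependence of the mixing constants
  (`FixedLengthNoConductivityControl`: the tree decides nothing about it) is not claimed away — it is PRICED, inside a logarithm, as kick-window width.
  `(RT_p)` polynomial relaxation `ρ_N = O(N^p)` ⟺ NODE 112's `(KD_p)` up to `N^ε` (`bathKernelHorizonDecay_of_relaxTimePoly`,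
  `relaxTimePoly_of_kernelDecay`).
* §12 the ladder, every arrow proved.

RESIDUAL TREE (one screen).  11071 ⟸ (S) ∧ `LateTailFloor a 1 1` [tree] and
  `LateTailFloor a 1 1` ⟸ (HMmix_a)                                   [★★★ this node, ONE open piece; `lateTailFloor_one_of_mixing`]
  `LateTailFloor a 1 1` ⟸ (HZᶠ_{q,1}) ∧ (HMlog_{a,q}),  q ≥ 3          [★★★ this node; (HMlog) ⟸ (HM_{a,q,δ}) PROVED; (HZᶠ_{q,1}) ⟸ (KD_p), p < q, tree]
  `LateTailFloor a 1 1` ⟸ (HZᶠ[τ]_1) ∧ (HM[τ, W_T(τ)]_a), τ_N ≥ N³     [★★★ this node, the general door; (HZᶠ[τ^mix]_1) is a TREE THEOREM here]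
Open pieces and tags: (HMmix_a) UNDECIDED · INSTRUMENTABLE with a proxy for `ρ_N` · IDEA-NEEDED · phonon-TRUE; (HMlog_{a,q}) UNDECIDED ·
INSTRUMENTABLE (KICK readouts on `k² ≤ 8T((2q+4)log N+1)`) · IDEA-NEEDED · phonon-TRUE; (HZᶠ_{q,1}) / (KD_p) / (RT_p) UNDECIDED · LITERATURE-FED
(forecasting ceiling of the cell: no checked theorem produces an `N`-explicit rate; [Lu 2026, arXiv:2607.13953, p. 4]: «these works establish
fixed-`N` ergodicity»; sharp `N^{−3}` only for the harmonic chain [BeckerMenegaki2022] and weakly anharmonic perturbations [Menegaki2020]).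

WHAT IS NEW relative to NODE 111/112 (all three are theorems, not forecasts): (i) the confinement price of an `L²` budget `P` drops from `P^{1/j}`
to `8T·log P` (Gaussian, not polynomial, tail accounting); (ii) hence NODE 112's confined piece is replaced by a PROVABLY WEAKER one at the same
horizon (`horizonReturnMonotoneLog_of_on`), the window shrinking from `T·N^δ` to `O(T·log N)`; (iii) the first door in the cell where a CONFINED
shape statement ALONE implies the floor: NODE 111's one-piece door `lateHeatReturnFloor_of_monotone` needs monotonicity for ALL kicks at INFINITE
horizon, NODE 112's confined door needs the forecasting piece `(HZᶠ)`; here per-`N` mixing (already in the tree) discharges `(HZᶠ)` at the mixing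
horizon and the Gaussian lemma makes the resulting `log ρ_N` affordable as window width.

HONEST LEDGER — what is NOT claimed.  (1) No implication between (HMmix_a) and (HM_{a,q,δ}) / (HMlog_{a,q}) either way (different horizons:
`τ^mix_N` vs `N^q`); (HMmix) is the weaker ask only in the regime `log ρ_N = O(N^δ)` — if the boundary kernel relaxed slower than
stretched-exponentially in `N`, the log-mixing window would exceed NODE 112's power window (and NODE 112's `(HZᶠ_{q,1})` would be hopeless
anyway). (2) Nothing `N`-uniform is asserted anywhere: `ρ_N` is finite per `N` and enters only through `log ρ_N`. (3) `(HZᶠ[τ]_1)` at SUB-mixing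
horizons stays forecasting-hard (critic row 1491); this node does not touch it — it removes it by choosing the horizon. (4) The instrumentable
feeders need KICK readouts up to the mixing horizon, which the census cannot reach when `ρ_N ≫ N²` (BKER-110 reaches lags `≲ N²`): (HMmix) is
INSTRUMENTABLE only together with a numerical proxy for `ρ_N`; (HMlog_{a,q}) is instrumentable as NODE 112's piece was, on a smaller window.

BARRIERS (catalogued, `Literature/Barriers/AtomisticToContinuum/`).  `FixedLengthNoConductivityControl`: every door here is a fixed-parameter,
eventually-in-`N` statement whose constants may depend on everything; the node sits OUTSIDE the barrier's class (no fixed-length quantity is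
promoted to an `N`-uniform one) — the unknown growth of the mixing constants is PRICED (window `16T·log ρ_N`), not assumed away.
`SpectralGapClosingEquilibrium` / `SpectralGapClosing` (`L²` rates close at least like `N^{−1/2}`): irrelevant to the doors (the horizon absorbs
any polynomial or even stretched-exponential closing at logarithmic cost); it constrains only `(RT_p)`/`(KD_p)` to `p ≥ 1/2`.
`HarmonicCrystalBallistic` / `BoundaryTapNormPersistence` / `StrongPinningBreathers*` / `LowTemperatureWeakAnharmonicity`: not in the technique
class of this node (no transport coefficient, no perturbation in `lam, β`, no low-temperature expansion); the breather phenomenology IS the named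
failure mode of (HMmix) below.

FAILURE MODES of the open piece (HMmix_a) (why it might be FALSE): hard-kick saturation INSIDE the log-mixing window — a kick of energy
`≍ T·log ρ_N` at the pinned boundary site is off-resonance with the phonon band (quartic pinning), stays localised as a boundary breather and
drains into the bath EARLY, so its LATE-weighted return `Ḡ_{N,u}(k)`, `u > aN`, can fall BELOW that of a softer, band-resonant kick: monotonicity
in `k²` would then fail near the top of the window exactly when `ρ_N` is large.  Cheapest falsifier: census KICK readouts `Ḡ_{N,u}(k)` at
`N ∈ {8,16,32}`, `u ∈ (N, N²]`, `k² ∈ [4T, 80T·log N]` — a single robust inversion `Ḡ(k₁) > Ḡ(k₂)`, `k₁² < k₂²`, inside the window refutes the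
instrumentable feeder (not yet (HMmix) itself, which only needs the `u`-integrated curve).

Main file (part 4 of 4) of the chain `…BathHeatLogWindowA` (§8–§9) → `…B` (§10) → `…C` (§11) → this file (§11b `(RT_p)` ⟺ `(KD_p)`, §12 the ladder +
this overview); the chain imports only the tree (NODE 112 `…BathHeatHorizonReturn`, hence NODE 108–111 and the LateTail files). 0 `sorry`.

House rules of the cell: sorry-free, no new axioms, no `instance`/`notation`, every `def` a plain `Prop`/function, statements tagged
[tree] / [this cell] / [elementary] / [folklore] / [route statement · NOT a literature fact].
-/


noncomputable section

open MeasureTheory ProbabilityTheory Filter Topology Set Function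
open scoped NNReal ENNReal
open Literature.MathematicalPhysics.KineticTheory.HeatConduction
open Literature.MathematicalPhysics.KineticTheory OscillatorChain
open Literature.Probability.Process
open Summit.AtomisticToContinuum.FouriersLaw.Theorems.SubdiffusiveBondHeat (boundaryKernelBasics_proof)

namespace Summit.AtomisticToContinuum.FouriersLaw.Theorems.BoundedResponse.HeatSpreading

/-! ## §11b (NODE 113) The relaxation time and NODE 112's `(KD_p)`: polynomial relaxation, both directions -/

section RelaxPoly

/-- **(RT_p) `RelaxTimePoly p`** — POLYNOMIAL RELAXATION: eventually `ρ_N ≤ C·N^p`.  `⟹ (KD_p)` (`bathKernelHorizonDecay_of_relaxTimePoly`) and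
`⟸ (KD_p)` up to `N^ε` (`relaxTimePoly_of_kernelDecay`: `(KD_p) ⟹ (RT_{p'})` for every `p' > p ≥ 0`, indeed `ρ_N = O(N^p·log N)`): the relaxation
time IS the object NODE 112's literature-typed piece talks about.  Under `(RT_p)` the log-mixing window is `(16p + 80 + o(1))·T·log N`.
Tag: UNDECIDED · LITERATURE-SHAPED (harmonic `p = 3` [BeckerMenegaki2022]; weakly anharmonic, non-uniform constants [Menegaki2020], [Lu2026
arXiv:2607.13953]) · the `SpectralGapClosingEquilibrium` barrier forbids only `p < 1/2`. [route statement · this cell; NOT a literature fact] -/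
def RelaxTimePoly (p : ℝ) : Prop :=
  ∀ ω₂ lam β γ : ℝ, 0 < ω₂ → 0 < lam → 0 < β → 0 < γ → ∀ T : ℝ, 0 < T →
    ∃ C : ℝ, ∃ N₀ : ℕ, ∀ N : ℕ, N₀ ≤ N → relaxTime ω₂ lam β γ T N ≤ C * (N : ℝ) ^ p

/-- ★ `(RT_p) ⟹ (KD_p)` (with `C = 2eT²`, `m = 0`, rate `1/C_ρ`). [this cell] -/
theorem bathKernelHorizonDecay_of_relaxTimePoly {p : ℝ} (h : RelaxTimePoly p) : BathKernelHorizonDecay p := by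
  intro ω₂ lam β γ hω hl hβ hγ T hT
  obtain ⟨C, N₀, hC⟩ := h ω₂ lam β γ hω hl hβ hγ T hT
  -- `C > 0` eventually forced by `ρ_N ≥ 1`; use `N₁ = max N₀ 1`
  have hC0 : 0 < C := by
    have h1 := hC (max N₀ 1) (le_max_left _ _)
    have hN1 : (1 : ℝ) ≤ ((max N₀ 1 : ℕ) : ℝ) := by exact_mod_cast le_max_right _ _
    have hρ1 := one_le_relaxTime ω₂ lam β γ T (max N₀ 1)
    have hpow : 0 < ((max N₀ 1 : ℕ) : ℝ) ^ p := Real.rpow_pos_of_pos (by linarith) _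
    by_contra hle
    have : C * ((max N₀ 1 : ℕ) : ℝ) ^ p ≤ 0 := mul_nonpos_of_nonpos_of_nonneg (not_lt.1 hle) hpow.le
    linarith
  refine ⟨2 * T ^ 2 * Real.exp 1, 0, 1 / C, by positivity, max N₀ 1, fun N hN r hr => ?_⟩
  have hNN₀ : N₀ ≤ N := le_trans (le_max_left _ _) hN
  have hN1 : 1 ≤ N := le_trans (le_max_right _ _) hN
  have hN0 : (0 : ℝ) < N := by exact_mod_cast hN1
  have hρ := relaxTime_mem hω hl hβ hγ hT hN1
  have hρC := hC N hNN₀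
  have hρ0 : 0 < relaxTime ω₂ lam β γ T N := zero_lt_one.trans_le (one_le_relaxTime ω₂ lam β γ T N)
  have hCN : 0 < C * (N : ℝ) ^ p := mul_pos hC0 (Real.rpow_pos_of_pos hN0 _)
  calc |bathKinCorr ω₂ lam β γ T N r| ≤ 2 * T ^ 2 * Real.exp (1 - r / relaxTime ω₂ lam β γ T N) := hρ.2 r hr
    _ ≤ 2 * T ^ 2 * Real.exp 1 * (N : ℝ) ^ (0 : ℝ) * Real.exp (-(1 / C * r / (N : ℝ) ^ p)) := by
        rw [Real.rpow_zero, mul_one, mul_assoc (2 * T ^ 2), ← Real.exp_add]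
        refine mul_le_mul_of_nonneg_left (Real.exp_le_exp.2 ?_) (by positivity)
        have : 1 / C * r / (N : ℝ) ^ p = r / (C * (N : ℝ) ^ p) := by
          field_simp
        rw [this]
        have : r / (C * (N : ℝ) ^ p) ≤ r / relaxTime ω₂ lam β γ T N := div_le_div_of_nonneg_left hr hρ0 hρC
        linarith

/-- ★ `(KD_p) ⟹ (RT_{p'})` for every `p' > p ≥ 0`: under NODE 112's polynomial-rate kernel decay `|K_N(r)| ≤ C·N^m·e^{−cr/N^p}` the canonical
relaxation time is polynomial, `ρ_N ≤ 2 + (2/c)·N^p·((1 + |log C₊| + |log 2T²|) + m₊·N^{p'−p}/(p'−p))` (`C₊ = max C 1`, `m₊ = max m 0`). [this cell] -/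
theorem relaxTimePoly_of_kernelDecay {p p' : ℝ} (hp : 0 ≤ p) (hpp' : p < p') (h : BathKernelHorizonDecay p) : RelaxTimePoly p' := by
  intro ω₂ lam β γ hω hl hβ hγ T hT
  obtain ⟨C, m, c, hc, N₀, hK⟩ := h ω₂ lam β γ hω hl hβ hγ T hT
  obtain ⟨δ, hδ⟩ : ∃ x : ℝ, x = p' - p := ⟨_, rfl⟩
  have hδ0 : 0 < δ := by rw [hδ]; linarith
  have hp' : p' = p + δ := by rw [hδ]; ring
  obtain ⟨Cp, hCp⟩ : ∃ x : ℝ, x = max C 1 := ⟨_, rfl⟩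
  obtain ⟨mp, hmp⟩ : ∃ x : ℝ, x = max m 0 := ⟨_, rfl⟩
  have hCp1 : 1 ≤ Cp := hCp ▸ le_max_right _ _
  have hCCp : C ≤ Cp := hCp ▸ le_max_left _ _
  have hCp0 : 0 < Cp := by linarith
  have hmp0 : 0 ≤ mp := hmp ▸ le_max_right _ _
  have hmmp : m ≤ mp := hmp ▸ le_max_left _ _
  obtain ⟨Q, hQ⟩ : ∃ x : ℝ, x = 1 + |Real.log Cp| + |Real.log (2 * T ^ 2)| := ⟨_, rfl⟩
  have hQ1 : 1 ≤ Q := by rw [hQ]; linarith [abs_nonneg (Real.log Cp), abs_nonneg (Real.log (2 * T ^ 2))]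
  obtain ⟨E, hE⟩ : ∃ x : ℝ, x = mp / δ := ⟨_, rfl⟩
  have hE0 : 0 ≤ E := by rw [hE]; exact div_nonneg hmp0 hδ0.le
  obtain ⟨F, hF⟩ : ∃ x : ℝ, x = 2 / c := ⟨_, rfl⟩
  have hF0 : 0 ≤ F := by rw [hF]; exact div_nonneg zero_le_two hc.le
  have hQE : 0 ≤ Q + E := by linarith
  refine ⟨2 + F * (Q + E), max N₀ 1, fun N hN => ?_⟩
  have hNN₀ : N₀ ≤ N := le_trans (le_max_left _ _) hN
  have hN1 : 1 ≤ N := le_trans (le_max_right _ _) hN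
  have hN1r : (1 : ℝ) ≤ N := by exact_mod_cast hN1
  have hN0 : (0 : ℝ) < N := by linarith
  have hKb := (bathKinCorr_basics hω hl hβ hγ hT hN1).2.1
  have hNp : 0 < (N : ℝ) ^ p := Real.rpow_pos_of_pos hN0 _
  have hc' : 0 < c / (N : ℝ) ^ p := div_pos hc hNp
  -- the `(KD)` bound in the shape `C'·e^{−c'r}`, `C' = C₊·N^{m₊}`, `c' = c/N^p`
  have hK' : ∀ r : ℝ, 0 ≤ r → |bathKinCorr ω₂ lam β γ T N r| ≤ Cp * (N : ℝ) ^ mp * Real.exp (-(c / (N : ℝ) ^ p) * r) := by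
    intro r hr
    have h1 := hK N hNN₀ r hr
    have e : -(c * r / (N : ℝ) ^ p) = -(c / (N : ℝ) ^ p) * r := by ring
    rw [e] at h1
    refine h1.trans (mul_le_mul_of_nonneg_right ?_ (Real.exp_pos _).le)
    have hNm : (N : ℝ) ^ m ≤ (N : ℝ) ^ mp := Real.rpow_le_rpow_of_exponent_le hN1r hmmp
    have hNm0 : 0 < (N : ℝ) ^ m := Real.rpow_pos_of_pos hN0 _
    calc C * (N : ℝ) ^ m ≤ Cp * (N : ℝ) ^ m := mul_le_mul_of_nonneg_right hCCp hNm0.le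
      _ ≤ Cp * (N : ℝ) ^ mp := mul_le_mul_of_nonneg_left hNm hCp0.le
  have hmem := mem_relaxTimeSet_of_expBound hT hKb hc' hK'
  have hρ := relaxTime_le_of_mem hmem
  -- bound the explicit admissible time by `1 + F·N^p·(Q + E)·N^δ`
  have hlog : Real.log (Cp * (N : ℝ) ^ mp) = Real.log Cp + mp * Real.log N := by
    rw [Real.log_mul hCp0.ne' (Real.rpow_pos_of_pos hN0 _).ne', Real.log_rpow hN0]
  have hX1 : (1 : ℝ) ≤ (N : ℝ) ^ δ := Real.one_le_rpow hN1r hδ0.le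
  have h3 : mp * Real.log N ≤ E * (N : ℝ) ^ δ := by
    have := mul_le_mul_of_nonneg_left (Real.log_le_rpow_div hN0.le hδ0) hmp0
    calc mp * Real.log N ≤ mp * ((N : ℝ) ^ δ / δ) := this
      _ = E * (N : ℝ) ^ δ := by rw [hE]; ring
  have hY : max 1 (Real.log (Cp * (N : ℝ) ^ mp) - Real.log (2 * T ^ 2) - 1) ≤ (Q + E) * (N : ℝ) ^ δ := by
    rw [hlog]
    have h1 : Real.log Cp ≤ |Real.log Cp| := le_abs_self _
    have h2 : -Real.log (2 * T ^ 2) ≤ |Real.log (2 * T ^ 2)| := neg_le_abs _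
    have h4 : Q + E ≤ (Q + E) * (N : ℝ) ^ δ := le_mul_of_one_le_right hQE hX1
    have h5 : Q ≤ Q * (N : ℝ) ^ δ := le_mul_of_one_le_right (by linarith) hX1
    refine max_le ?_ ?_
    · linarith
    · nlinarith
  have hY0 : 0 ≤ (Q + E) * (N : ℝ) ^ δ := mul_nonneg hQE (by positivity)
  have hdiv : 2 / (c / (N : ℝ) ^ p) = F * (N : ℝ) ^ p := by rw [hF, div_div_eq_mul_div]; ring
  have hFN : 0 ≤ F * (N : ℝ) ^ p := mul_nonneg hF0 hNp.le
  have hρ' : max 1 (2 / (c / (N : ℝ) ^ p) * max 1 (Real.log (Cp * (N : ℝ) ^ mp) - Real.log (2 * T ^ 2) - 1)) ≤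
      1 + F * (N : ℝ) ^ p * ((Q + E) * (N : ℝ) ^ δ) := by
    rw [hdiv]
    have h6 := mul_le_mul_of_nonneg_left hY hFN
    have h7 := mul_nonneg hFN hY0
    exact max_le (by linarith) (by linarith)
  have hpow : (N : ℝ) ^ p * (N : ℝ) ^ δ = (N : ℝ) ^ p' := by rw [hp', Real.rpow_add hN0]
  have hP1 : (1 : ℝ) ≤ (N : ℝ) ^ p' := Real.one_le_rpow hN1r (by linarith)
  have h8 : relaxTime ω₂ lam β γ T N ≤ 2 + F * (Q + E) * ((N : ℝ) ^ p * (N : ℝ) ^ δ) := by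
    have e : F * (N : ℝ) ^ p * ((Q + E) * (N : ℝ) ^ δ) = F * (Q + E) * ((N : ℝ) ^ p * (N : ℝ) ^ δ) := by ring
    linarith [hρ, hρ', e.le, e.ge]
  rw [hpow] at h8
  have h9 : 0 ≤ F * (Q + E) := mul_nonneg hF0 hQE
  nlinarith

end RelaxPoly

/-! ## §12 (NODE 113) The LADDER: every arrow proved -/

section Ladder

/-- **THE LADDER OF NODE 113** (`0 ≤ a`, `3 ≤ q`, `0 < δ`; every arrow PROVED):
(1) NODE 112's piece is stronger: `(HM_{a,q,δ}) ⟹ (HMlog_{a,q})`;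
(2) the log-window door: `(HZᶠ_{q,1}) ∧ (HMlog_{a,q}) ⟹ LateTailFloor a 1 1`, fed by `(KD_p)`, `p < q`;
(3) the general door along any horizon `τ_N ≥ N³` with its log window;
(4) the mixing door, ONE open piece: `(HMmix_a) ⟹ LateTailFloor a 1 1`;
(5) with (S): `(HMmix_a) ⟹ 11071`, `(HZᶠ_{q,1}) ∧ (HMlog_{a,q}) ⟹ 11071`;
(6) the relaxation time is NODE 112's object: `(RT_p) ⟹ (KD_p)`, `(KD_p) ⟹ (RT_{p'})` (`0 ≤ p < p'`). [this cell] -/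
theorem logWindowLadder {a δ : ℝ} {q : ℕ} (ha : 0 ≤ a) (hq : 3 ≤ q) (hδ : 0 < δ) :
    (HorizonReturnMonotoneOn a q δ → HorizonReturnMonotoneLog a q) ∧
    (HorizonRemainderFloor q 1 → HorizonReturnMonotoneLog a q → LateTailFloor a 1 1) ∧
    (∀ p : ℝ, p < q → BathKernelHorizonDecay p → HorizonReturnMonotoneLog a q → LateTailFloor a 1 1) ∧
    (∀ τ : ℕ → ℝ, (∀ N : ℕ, (N : ℝ) ^ 3 ≤ τ N) → HorizonRemainderFloorAt τ 1 →
      HorizonReturnMonotoneWithin a τ (logWindow τ) → LateTailFloor a 1 1) ∧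
    (HorizonReturnMonotoneMixing a → LateTailFloor a 1 1) ∧
    (Theses.BondHeatUncertainty.SubdiffusiveBondHeat → HorizonReturnMonotoneMixing a → Theses.BondHeatUncertainty.BoundedResponse) ∧
    (Theses.BondHeatUncertainty.SubdiffusiveBondHeat → HorizonRemainderFloor q 1 → HorizonReturnMonotoneLog a q →
      Theses.BondHeatUncertainty.BoundedResponse) ∧
    (∀ p : ℝ, RelaxTimePoly p → BathKernelHorizonDecay p) ∧
    (∀ p p' : ℝ, 0 ≤ p → p < p' → BathKernelHorizonDecay p → RelaxTimePoly p') :=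
  ⟨horizonReturnMonotoneLog_of_on hδ, lateTailFloor_one_of_horizon_log ha hq,
    fun _ hpq hK hM => lateTailFloor_one_of_kernelDecay_log ha hq hpq hK hM,
    fun _ hτ3 hZ hM => lateTailFloor_one_of_horizonAt_logWindow ha hτ3 hZ hM,
    lateTailFloor_one_of_mixing ha, fun hS hM => boundedResponse_of_subdiffusiveBondHeat_mixing ha hS hM,
    fun hS hZ hM => boundedResponse_of_subdiffusiveBondHeat_horizon_log ha hq hS hZ hM,
    fun _ h => bathKernelHorizonDecay_of_relaxTimePoly h, fun _ _ hp hpp' h => relaxTimePoly_of_kernelDecay hp hpp' h⟩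

end Ladder

end Summit.AtomisticToContinuum.FouriersLaw.Theorems.BoundedResponse.HeatSpreading

end
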